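import Literature.Computability.AlgebraicComplexity.BorderHittingSetsExist
import Literature.Computability.AlgebraicComplexity.PolynomialKoszulYoungFlatteningMonotone
import HarnessLib

/-!
# Hitting sets of size `n² + 1` EXIST for every orbit closure `\overline{GL_n · f}`
# (Heintz–Schnorr 1980, Thm. 4.4 — existence half, in the orbit-closure currency of
# Mulmuley–Sohoni 2001 §4)

Topic: `Literature/Computability/AlgebraicComplexity` (theorem-only; no definitions, no named facts).

**Theorem (`BorderHittingSets.exists_hittingSet_orbitClosure`).** Let `K` be an infinite field,
`σ` a finite set of `n` variables and `f ∈ K[x_σ]` ANY polynomial. Then there is a set `H ⊆ K^σ`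
of at most `n² + 1` points such that every non-zero `g` in the orbit closure
`Δ[f] = \overline{GL_n(K) · f}` (the tree's `orbitClosure f`: `coeff g` in the Zariski closure of the
coefficient vectors of the orbit, `OrbitClosure.lean`, Mulmuley–Sohoni 2001 §4) satisfies
`g(x) ≠ 0` for some `x ∈ H`.

This is the Heintz–Schnorr existence theorem [HS80, Thm. 4.4] / [CKRST20, arXiv v4 Thm. 3.2–3.3]
("for `W` the closure of the set of coefficient vectors of a class given by a polynomial map
`Q : ℂ^m → ℂ^N` … there exist hitting sets of size `10 · dim W`") for the polynomial map
`A ↦ coeff (A · f)` on ALL `n × n` matrices (`m = n²` parameters): the orbit `GL · f` lies in the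
endomorphism orbit `End(K^n) · f` (`glOrbit_subset_endOrbit`), which is the set of `K`-members of
ONE generic member — `f(X^{gen} x)` with an `n × n` matrix of indeterminates — so
`Δ[f] ⊆ \overline{coeff(End · f)}` is covered by the engine's Zariski form
`BorderHittingSets.exists_hittingSet_zariskiClosure` with `#ι + 1 = n² + 1` points; an arbitrary
finite variable type is reached by renaming (`rename_equiv_mem_orbitClosure`,
`PolynomialKoszulYoungFlatteningMonotone.lean`). Existence only: the points are not explicit and
their coordinates are not bounded (the printed `[b]^n` needs Bézout); explicit hitting sets for
orbits and orbit closures of SPECIFIC families are the subject of Medini–Shpilka 2021 and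
Saha–Thankey 2021 (tree: `MS21*`, `ST21*` files). Honest framing: a 1980 existence theorem in the
GCT vocabulary; it says nothing about `Δ[det_m]` versus `Δ[per_m]` and nothing about VP versus VNP,
which is NOT proved.

## References

* [HeintzSchnorr1980] J. Heintz, C.-P. Schnorr, *Testing polynomials which are easy to compute*,
  STOC 1980, Thm. 4.4.
* [ChatterjeeKumarRamyaSaptharishiTengse2020] arXiv:2004.14147v4 §3.1, Thms. 3.2–3.3.
* [MulmuleySohoni2001] K. Mulmuley, M. Sohoni, *Geometric complexity theory I*, SIAM J. Comput. 31
  (2001), §4 (orbit closures `Δ[f]`).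
* [MediniShpilka2021] D. Medini, A. Shpilka, *Hitting sets and reconstruction for dense orbits in
  VP_e and ΣΠΣ circuits*, CCC 2021, §1 (hitting sets for orbits and their closures).
-/

noncomputable section

open MvPolynomial

namespace Literature.Computability.AlgebraicComplexity

namespace BorderHittingSets

universe u

variable {K : Type u} [Field K]

/-! ## `n` numbered variables: the endomorphism orbit as the `K`-members of one generic member -/

section FinCase

variable {n : ℕ}

/-- **Every linear substitution `A · f` is a `K`-member of the generic substitution
`f(X^{gen} x)`** (`X i ↦ Σ_j y_{(j,i)} X_j` with indeterminates `y_{(j,i)}`, specialised at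
`y_{(j,i)} = A j i`). [cite: MulmuleySohoni2001, §4 (the action A · f)] -/
theorem isMember_linSubst (f : MvPolynomial (Fin n) K) (A : Matrix (Fin n) (Fin n) K) :
    IsMember (fun _ : Unit => aeval (fun i : Fin n =>
        ∑ j : Fin n, C (X (j, i) : MvPolynomial (Fin n × Fin n) K) * X j) f)
      K (linSubst (Fin n) K A f) := by
  refine ⟨(), fun p => A p.1 p.2, ?_⟩
  set β : Fin n × Fin n → K := fun p => A p.1 p.2 with hβ
  have hcomp : (linSubst (Fin n) K A : MvPolynomial (Fin n) K →ₐ[K] MvPolynomial (Fin n) K) =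
      (mapAlgHom (aeval β : MvPolynomial (Fin n × Fin n) K →ₐ[K] K)).comp
        (aeval fun i : Fin n =>
          ∑ j : Fin n, C (X (j, i) : MvPolynomial (Fin n × Fin n) K) * X j) := by
    refine MvPolynomial.algHom_ext fun i => ?_
    simp only [linSubst_X, AlgHom.comp_apply, aeval_X, map_sum, map_mul, mapAlgHom_apply, map_X,
      map_C, smul_eq_C_mul]
    refine Finset.sum_congr rfl fun j _ => ?_
    simp [hβ]
  have := congrArg (fun φ : MvPolynomial (Fin n) K →ₐ[K] MvPolynomial (Fin n) K => φ f) hcomp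
  simpa [mapAlgHom_apply] using this

/-- **Hitting sets of size `n² + 1` exist for `Δ[f]`, `n` numbered variables.** Over an infinite
field, for every `f ∈ K[x_1, …, x_n]` there is `H ⊆ K^n` with `|H| ≤ n² + 1` hitting every
non-zero `g ∈ orbitClosure f` (`GL · f ⊆ End · f =` the `K`-members of the generic substitution,
then `exists_hittingSet_zariskiClosure` with `n²` parameters).
[cite: HeintzSchnorr1980, Thm. 4.4; MulmuleySohoni2001, §4] -/
theorem exists_hittingSet_orbitClosure_fin [Infinite K] (f : MvPolynomial (Fin n) K) :
    ∃ H : Finset (Fin n → K), H.card ≤ n ^ 2 + 1 ∧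
      HittingSets.IsHittingSetFor (↑H : Set (Fin n → K)) (orbitClosure f) := by
  classical
  obtain ⟨H, hcard, hH⟩ := exists_hittingSet_zariskiClosure (fun _ : Unit => aeval (fun i : Fin n =>
    ∑ j : Fin n, C (X (j, i) : MvPolynomial (Fin n × Fin n) K) * X j) f)
  refine ⟨H, ?_, fun g hg hg0 => hH g hg0 (zariskiClosure_mono (Set.image_mono ?_) hg)⟩
  · rw [Fintype.card_prod, Fintype.card_fin] at hcard
    rw [sq]
    exact hcard
  · rintro _ ⟨A, rfl⟩
    exact isMember_linSubst f (A : Matrix (Fin n) (Fin n) K)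

end FinCase

/-! ## Arbitrary finite variable types -/

/-- **Hitting sets of size `n² + 1` exist for every orbit closure `\overline{GL_n · f}`** (any
finite variable type `σ`, `n = #σ`, `K` infinite): there is `H ⊆ K^σ`, `|H| ≤ n² + 1`, such that
every non-zero `g ∈ Δ[f] = orbitClosure f` has `g(x) ≠ 0` for some `x ∈ H`. From the numbered case
by renaming along `σ ≃ Fin n` (`rename_equiv_mem_orbitClosure`; `eval x (rename e g) = eval (x ∘ e) g`).
Heintz–Schnorr's existence theorem for the closure of the image of the polynomial map
`A ↦ coeff(A · f)` on `n × n` matrices. [cite: HeintzSchnorr1980, Thm. 4.4; MulmuleySohoni2001, §4] -/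
theorem exists_hittingSet_orbitClosure {σ : Type*} [Fintype σ] [DecidableEq σ] [Infinite K]
    (f : MvPolynomial σ K) :
    ∃ H : Finset (σ → K), H.card ≤ Fintype.card σ ^ 2 + 1 ∧
      ∀ g ∈ orbitClosure f, g ≠ 0 → ∃ x ∈ H, eval x g ≠ 0 := by
  classical
  set e := Fintype.equivFin σ with he
  obtain ⟨H, hcard, hH⟩ := exists_hittingSet_orbitClosure_fin (K := K) (rename e f)
  refine ⟨H.image fun x => x ∘ e, Finset.card_image_le.trans hcard, fun g hg hg0 => ?_⟩
  obtain ⟨x, hx, hne⟩ := hH (rename e g) (rename_equiv_mem_orbitClosure e hg)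
    (fun h => hg0 (rename_injective _ e.injective (by rw [h, map_zero])))
  refine ⟨x ∘ e, Finset.mem_image_of_mem _ hx, ?_⟩
  rwa [eval_rename] at hne

end BorderHittingSets

end Literature.Computability.AlgebraicComplexity

end
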